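import Summits.AtomisticToContinuum.HydrodynamicLimit.Theses.CollisionIsometryCLT
import Literature.Analysis.FluidPDE.HardSphereAlexander

/-!
# Disproof of `DiffuseBackwardInfluence` (crux `stmt-AtomisticToContinuum-12950`) — standing adversary file

Refuter seat `refuter-cdisprove-stmt-AtomisticToContinuum-12950-0`, cycle 1 (2026-08-16).
Route `CollisionIsometryCLT`, decl
`Summit.AtomisticToContinuum.HydrodynamicLimit.Theses.CollisionIsometryCLT.DiffuseBackwardInfluence`.

## Findings (index; details in the docstrings below)

* **F0 (read-back, no junk handle).** The crux elaborates (rc 0); `dbi_iff` certifies BY `Iff.rfl` that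
  it is, definitionally, the statement `DBI'` written over the named definitions `pre`/`step`/`transfer`/
  `rowIpr`/`ipr` of this file (so every lemma below is about the crux's own `let M`, `let ipr`).
  The transfer is a fold of `collidePair … .2` at the realised pre-collisional positions of the Alexander
  construction; `reflectVel` divides by `‖n‖²`, so each step is an honest orthogonal involution (identity at
  normal `0`); `ipr ∈ [9/(N+1), 9]` given the row budget. Junk values (`collisionCount = 0` on Zeno orbits /
  outside the hard-sphere domain, `h.some` on multiple contacts) sit on Liouville-null sets *modulo the named
  facts* `Alexander.torusFlow_ae_good` / `torusFlow_measurePreserving` (defs, not yet theorems) — no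
  refutation handle, but provers inherit those facts as obligations. `localGibbsLaw` is a probability measure
  for `σ ≤ 1/2` and the flow type is inhabited for `σ < 1/2` (previous refuter seat, Scratch.lean on the item),
  so the `∀ Φ` is not vacuous and the expectation is not trivially `0`.
* **F1 (hypothesis `∀ N, 0 < Δ N` is REDUNDANT — proved).** `dbi_iff_withoutPos`: the crux is equivalent to
  the same statement without the positivity of the window (eventual positivity follows from
  `Δ_N (N+1)^{1/3} → ∞`, and `Tendsto` ignores finitely many `N`). Provers may drop it; planners need not
  repair anything.
* **F2 (hypothesis `Δ_N → 0` is NOT load-bearing for THIS crux — heuristic, no theorem).** Longer windows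
  only add collisions; the equilibrium MD of the item (kit j007601, `IdeatorOneG2KitResults.md`:
  `−log(ipr/9)` grows ≈ 0.30–0.35 per collision per particle down to the floor `9/N`, at φ = 0.05/0.20/0.45)
  shows monotone delocalisation in the collision count. `Δ_N → 0` is load-bearing only downstream
  (locality of the CLT in `AdaptedWeightCLT`). Likewise `σ < σ₀` (smallness) is not visibly load-bearing
  here: the dense fluid φ = 0.45 delocalises per collision only 10–20 % slower (j007601).
* **F3 (hypothesis `Δ_N (N+1)^{1/3} → ∞` IS load-bearing — necessity proved, falsity of the weakened
  crux NOT provable here).** `nine_mul_idleFrac_le_ipr`: pointwise, `ipr ≥ 9 ×` (fraction of particles that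
  belong to no colliding pair of the window) — rows of idle particles are untouched (`transfer_apply_of_idle`,
  `rowIpr_of_idle`). Hence `fewIdle_of_dbi`: the crux IMPLIES that the local-Gibbs-evolved expected idle
  fraction tends to `0` on every admissible window (FewCollisionsRare at `m = 0` is NECESSARY, not only
  sufficient: any proof of the crux proves it). With `Δ_N = (N+1)^{-1}` (growth dropped) the expected idle
  fraction tends to `1` at equilibrium (≍ `exp(−C σ² Δ_N (N+1)^{1/3})`), so `DBIWithoutGrowth` is false —
  PROVED as `dbiWithoutGrowth_false_of` MODULO two named hypotheses (no sorry): `EqInvariantH` (invariance of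
  the canonical Gibbs law under `HardSphereFlow.flow`, the lines' `stub_eqInvariant`) and `IdleIntensityH` (the
  contact-intensity bound `E_G[idleFrac over [0,Δ]] ≥ 1 − C(N+1)^{1/3}Δ` — special-flow representation,
  CIP 1994 App. 4.A, not in the tree); the flow itself is Alexander's theorem `nonempty_torus_holds` (in tree).
* **F4 (no pathwise monotone functional — proved on the crux's own fold step).** `step_step`: the fold
  step of the crux is an involution (`collidePair_collidePair`), so repeating a step restores every row:
  `ℓ⁴`-participation (or any functional of `M`) cannot decrease pathwise along arbitrary reflection
  sequences (Loschmidt echo in one line; agrees with note N1 of `IdeatorOneG2BarrierNotes.md`). Every proof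
  must use the MEASURE of the realised sequences, never reflection algebra alone.
* **F5 (isotropy of the realised normals is load-bearing — proved on the crux's own transfer).**
  `inner_transfer_of_planar` / `one_le_rowIpr_of_planar` / `one_le_ipr_of_planar`: if every realised
  normal of the window is orthogonal to a fixed coordinate direction, the corresponding velocity components
  are invariants of the transfer and EVERY row keeps participation `≥ 1` (so `ipr ≥ 1`), however many
  collisions occur (`n_N → ∞` is not sufficient). Together with the coordinate-normal kernel
  `IdeatorOneG2.coordinateNormalsNoSplit_holds` (`ipr_i ≥ 3`, hard rods / cubic cage) this is the
  `_false_without_<normal non-degeneracy>` content: the natural strengthening "ipr_i ≤ f(#own collisions)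
  with f → 0" (the route's foreseen pointwise `NoReconcentration`) is FALSE; non-degeneracy of normals must
  enter through the law. (Planar/coordinate histories are Liouville-null in d = 3 — consistent with the crux.)
* **F7 (free directions — proved, §6).** `inner_transfer_of_spares`: particle `i`'s velocity changes only
  along the realised normals of its OWN collisions, so any unit `e` orthogonal to those is conserved at `i`;
  `one_le_rowIpr_of_free_direction` / `one_le_rowIpr_of_ownLeTwo`: at most two own collisions ⇒ `rowIpr_i ≥ 1`.
  Hence the crux forces the expected fraction of particles with `≤ 2` collisions per window to vanish
  (FewCollisionsRare for m ≤ 2 is NECESSARY; tight at m = 3: three orthonormal fresh collisions empty `M_ii`).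
  LANDED as `Theorems/DiffuseBackwardInfluence/Negative/FreeDirection.lean` (p74484, accepted); F3/F4/F5 landed as
  `Theorems/DiffuseBackwardInfluence/Negative/TransferKernels.lean` (p73088, accepted) — importable by every line.
* **F8 (tightness, model — proved, §7).** `selfBlock_zero_after_three`: with the crux's fold body at prescribed
  Euclidean snapshots (`mstep`), three own collisions at normals `e₀, e₁, e₂` with three FRESH partners send
  `M_ii` to `0`: the bound `a_ii ≥ 3 − m_i` behind F7 cannot be improved, and from the third collision on nothing
  algebraic keeps a row heavy.
* **F6 (no kill; why it resists).** No junk handle (F0); the only N-uniform obstructions found are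
  measure-zero arrangements (F4, F5) or super-exponentially rare under the invariant Gibbs law (cold comoving
  clusters ≈ `3δN log n_N` nats, tight cages ≈ `δN·3 log n_N`, triage TRIAGE-r1-1 and N2–N3 of the barrier
  notes), which the `O(N)` relative-entropy budget of local Gibbs data cannot buy; exponential-cost
  macrostates (dense droplets) delocalise in MD (j007601, φ = 0.45); this seat's MD (§8: j013787/j013790) shows
  N-independent decay to the 9/N floor for N = 256…4096 and benign non-equilibrium starts (shear, implosions, hot/cold, cold beams). A substantive `¬ DBI` would need an
  `e^{−O(N)}`-cheap macrostate holding `ipr > δ` through `n_N → ∞` collisions per particle — none known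
  (see NOTES.md §attacks for the list tried: isolated K-clusters, SC/FCC cages, beams, shear, implosion).
  Barrier catalogue: `BoltzmannHypothesisBarrier(Narrow)` kernels (free gas σ = 0: `M = I`, ipr ≡ 9; rods:
  permutation) are excluded by `σ > 0` + `n_N → ∞` + d = 3; `HighMomentumCutoff*`: bounded functional, n/a;
  `VelocityReversal*`: F4 is its pathwise shadow, the crux is in mean; `DiluteRegime*`: fixed σ, n/a.

## Targets
None yet (payload `targets = []`, no line picked). On re-arm the lead's stuck stubs go to `-- Targets` below.
-/

namespace Summit.AtomisticToContinuum.HydrodynamicLimit.Cruxes.DiffuseBackwardInfluence.Disproof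

open scoped BigOperators Topology ENNReal InnerProductSpace
open Filter Set MeasureTheory
open Literature.Analysis.FluidPDE Literature.MathematicalPhysics.KineticTheory
open Summit.AtomisticToContinuum.HydrodynamicLimit.Theses.CollisionIsometryCLT

noncomputable section

/-- Velocity space `ℝ³`. -/
abbrev V3 : Type := EuclideanSpace ℝ (Fin 3)
/-- Position space `𝕋³`. -/
abbrev T3 : Type := UnitAddTorus (Fin 3)
/-- Phase space of `N + 1` spheres on `𝕋³`. -/
abbrev Cfg (N : ℕ) : Type := Config (N + 1) (Fin 3) T3

/-! ## §1 The crux's `let`s as definitions, and the definitional restatement -/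

section Transfer

variable (σ : ℝ) (N : ℕ)

/-- The pre-collisional configuration of the `k`-th fold step (the crux's `pre k`). -/
def pre (y : Cfg N) (k : ℕ) : Cfg N :=
  let G := Torus.geometry (Fin 3)
  let ε : ℝ := hsDiameter σ N
  let zk := Alexander.stateAfter G ε y k
  freeFlight G (Alexander.freeExitTime G ε zk).toReal zk

/-- The incoming contact pairs seen by the `k`-th fold step. -/
def pairsAt (y : Cfg N) (k : ℕ) : Set (Fin (N + 1) × Fin (N + 1)) :=
  Alexander.incomingPairs (Torus.geometry (Fin 3)) (hsDiameter σ N) (pre σ N y k)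

/-- One fold step of the crux's transfer: the velocity part of `collidePair` of the chosen incoming
pair at the positions of `pre k`, applied to the velocity field `W'` (identity if no incoming pair). -/
def step (y : Cfg N) (W' : Fin (N + 1) → V3) (k : ℕ) : Fin (N + 1) → V3 :=
  @dite (Fin (N + 1) → V3) (pairsAt σ N y k).Nonempty (Classical.propDecidable _)
    (fun h => fun i =>
      (collidePair (Torus.geometry (Fin 3)) h.some.1 h.some.2
        (fun j => ((pre σ N y k j).1, W' j)) i).2)
    (fun _ => W')

/-- The number of fold steps: collisions of the Alexander construction from `y` in `[0, Δ]`. -/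
def colls (y : Cfg N) (Δ : ℝ) : ℕ :=
  Alexander.collisionCount (Torus.geometry (Fin 3)) (hsDiameter σ N) y Δ

/-- The frozen-geometry velocity transfer over `[0, Δ]` (the crux's `M N y Δ`). -/
def transfer (y : Cfg N) (Δ : ℝ) (W : Fin (N + 1) → V3) : Fin (N + 1) → V3 :=
  (List.range (colls σ N y Δ)).foldl (step σ N y) W

/-- Row participation of particle `i`: `Σ_k ‖M_ik‖_F⁴ = Σ_k (Σ_a ‖M (e_k ⊗ e_a) i‖²)²`. -/
def rowIpr (y : Cfg N) (Δ : ℝ) (i : Fin (N + 1)) : ℝ :=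
  ∑ k : Fin (N + 1),
    (∑ a : Fin 3, ‖transfer σ N y Δ (Pi.single k (EuclideanSpace.single a (1 : ℝ))) i‖ ^ 2) ^ 2

/-- The mean inverse participation ratio (the crux's `ipr N y Δ`). -/
def ipr (y : Cfg N) (Δ : ℝ) : ℝ :=
  ((N + 1 : ℕ) : ℝ)⁻¹ * ∑ i : Fin (N + 1), rowIpr σ N y Δ i

end Transfer

/-- The crux written over `transfer`/`ipr`. -/
def DBI' : Prop :=
  ∀ (a₀ θ₀ : T3 → ℝ) (u₀ : T3 → V3), Continuous a₀ → Continuous θ₀ → Continuous u₀ →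
    (∀ x, 0 < a₀ x) → (∀ x, 0 < θ₀ x) →
    ∃ σ₀ : ℝ, 0 < σ₀ ∧ ∀ σ : ℝ, 0 < σ → σ < σ₀ →
      ∀ Φ : (N : ℕ) → HardSphereFlow (Torus.geometry (Fin 3)) (hsDiameter σ N) (N + 1),
      ∀ Δ : ℕ → ℝ, (∀ N, 0 < Δ N) → Tendsto Δ atTop (𝓝 0) →
        Tendsto (fun N : ℕ => Δ N * ((N + 1 : ℕ) : ℝ) ^ ((1 : ℝ) / 3)) atTop atTop →
        ∀ t : ℝ, 0 < t →
          Tendsto (fun N : ℕ => ∫⁻ z, ENNReal.ofReal (ipr σ N ((Φ N).flow (t - Δ N) z) (Δ N))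
            ∂(localGibbsLaw σ a₀ u₀ θ₀ N (Φ N))) atTop (𝓝 0)

/-- **F0.** The restatement IS the crux, definitionally (`Iff.rfl`): every lemma of this file about
`transfer`/`ipr` is about the crux's own `let M`/`let ipr`. -/
theorem dbi_iff : DiffuseBackwardInfluence ↔ DBI' := Iff.rfl

/-! ## §2 (F1) The positivity hypothesis on the window is redundant -/

/-- The crux with the hypothesis `∀ N, 0 < Δ N` deleted. -/
def DBIWithoutPos : Prop :=
  ∀ (a₀ θ₀ : T3 → ℝ) (u₀ : T3 → V3), Continuous a₀ → Continuous θ₀ → Continuous u₀ →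
    (∀ x, 0 < a₀ x) → (∀ x, 0 < θ₀ x) →
    ∃ σ₀ : ℝ, 0 < σ₀ ∧ ∀ σ : ℝ, 0 < σ → σ < σ₀ →
      ∀ Φ : (N : ℕ) → HardSphereFlow (Torus.geometry (Fin 3)) (hsDiameter σ N) (N + 1),
      ∀ Δ : ℕ → ℝ, Tendsto Δ atTop (𝓝 0) →
        Tendsto (fun N : ℕ => Δ N * ((N + 1 : ℕ) : ℝ) ^ ((1 : ℝ) / 3)) atTop atTop →
        ∀ t : ℝ, 0 < t →
          Tendsto (fun N : ℕ => ∫⁻ z, ENNReal.ofReal (ipr σ N ((Φ N).flow (t - Δ N) z) (Δ N))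
            ∂(localGibbsLaw σ a₀ u₀ θ₀ N (Φ N))) atTop (𝓝 0)

/-- Growth of `Δ_N (N+1)^{1/3}` forces `Δ_N > 0` eventually. -/
theorem eventually_pos_of_growth {Δ : ℕ → ℝ}
    (hg : Tendsto (fun N : ℕ => Δ N * ((N + 1 : ℕ) : ℝ) ^ ((1 : ℝ) / 3)) atTop atTop) :
    ∀ᶠ N in atTop, 0 < Δ N := by
  filter_upwards [hg.eventually_ge_atTop 1] with N hN
  have hp : 0 < ((N + 1 : ℕ) : ℝ) ^ ((1 : ℝ) / 3) := Real.rpow_pos_of_pos (by positivity) _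
  by_contra hle
  have hle' : Δ N ≤ 0 := not_lt.1 hle
  have : Δ N * ((N + 1 : ℕ) : ℝ) ^ ((1 : ℝ) / 3) ≤ 0 := mul_nonpos_of_nonpos_of_nonneg hle' hp.le
  linarith

/-- **F1 (proved).** The crux is equivalent to its version without `∀ N, 0 < Δ N`: that hypothesis is
decoration (replace finitely many non-positive `Δ N` by `1`; `Tendsto` only sees the tail). -/
theorem dbi_iff_withoutPos : DiffuseBackwardInfluence ↔ DBIWithoutPos := by
  rw [dbi_iff]
  constructor
  · intro h a₀ θ₀ u₀ ha hθ hu ha0 hθ0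
    obtain ⟨σ₀, hσ₀, hσ⟩ := h a₀ θ₀ u₀ ha hθ hu ha0 hθ0
    refine ⟨σ₀, hσ₀, fun σ hσp hσlt Φ Δ hΔ0 hΔg t ht => ?_⟩
    have hpos := eventually_pos_of_growth hΔg
    set Δ' : ℕ → ℝ := fun N => if 0 < Δ N then Δ N else 1 with hΔ'def
    have hΔ'pos : ∀ N, 0 < Δ' N := by
      intro N
      simp only [hΔ'def]
      split_ifs with h
      · exact h
      · exact one_pos
    have heq : ∀ᶠ N in atTop, Δ' N = Δ N := by
      filter_upwards [hpos] with N hN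
      simp only [hΔ'def, if_pos hN]
    have h0' : Tendsto Δ' atTop (𝓝 0) := hΔ0.congr' (heq.mono fun N hN => hN.symm)
    have hg' : Tendsto (fun N : ℕ => Δ' N * ((N + 1 : ℕ) : ℝ) ^ ((1 : ℝ) / 3)) atTop atTop :=
      hΔg.congr' (heq.mono fun N hN => by simp only [hN])
    exact (hσ σ hσp hσlt Φ Δ' hΔ'pos h0' hg' t ht).congr' (heq.mono fun N hN => by simp only [hN])
  · intro h a₀ θ₀ u₀ ha hθ hu ha0 hθ0
    obtain ⟨σ₀, hσ₀, hσ⟩ := h a₀ θ₀ u₀ ha hθ hu ha0 hθ0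
    exact ⟨σ₀, hσ₀, fun σ hσp hσlt Φ Δ _ hΔ0 hΔg t ht => hσ σ hσp hσlt Φ Δ hΔ0 hΔg t ht⟩

/-! ## §3 (F3) Idle rows are untouched: FewCollisionsRare (m = 0) is NECESSARY -/

section Idle

variable {σ : ℝ} {N : ℕ}

/-- Particle `i` is *idle* in the window `[0, Δ]`: it is an endpoint of none of the fold's colliding
pairs (stated through `h.some`, the very pair the fold reflects). -/
def Idle (σ : ℝ) (N : ℕ) (y : Cfg N) (Δ : ℝ) (i : Fin (N + 1)) : Prop :=
  ∀ k < colls σ N y Δ, ∀ h : (pairsAt σ N y k).Nonempty, i ≠ h.some.1 ∧ i ≠ h.some.2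

/-- A fold step does not touch the velocity of a particle outside the reflected pair. -/
theorem step_apply_of_ne {y : Cfg N} {k : ℕ} {i : Fin (N + 1)}
    (hi : ∀ h : (pairsAt σ N y k).Nonempty, i ≠ h.some.1 ∧ i ≠ h.some.2)
    (W : Fin (N + 1) → V3) : step σ N y W k i = W i := by
  unfold step
  by_cases h : (pairsAt σ N y k).Nonempty
  · rw [dif_pos h, collidePair_apply_of_ne (hi h).1 (hi h).2]
  · rw [dif_neg h]

/-- Folding steps that never touch `i` leaves `W i` unchanged. -/
theorem foldl_step_apply {y : Cfg N} {i : Fin (N + 1)} (L : List ℕ)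
    (hL : ∀ k ∈ L, ∀ h : (pairsAt σ N y k).Nonempty, i ≠ h.some.1 ∧ i ≠ h.some.2)
    (W : Fin (N + 1) → V3) : (L.foldl (step σ N y) W) i = W i := by
  induction L generalizing W with
  | nil => rfl
  | cons k L ih =>
    rw [List.foldl_cons, ih (fun k' hk' => hL k' (List.mem_cons_of_mem _ hk')),
      step_apply_of_ne (hL k List.mem_cons_self)]

/-- **Rows of idle particles are untouched by the transfer.** -/
theorem transfer_apply_of_idle {y : Cfg N} {Δ : ℝ} {i : Fin (N + 1)} (hi : Idle σ N y Δ i)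
    (W : Fin (N + 1) → V3) : transfer σ N y Δ W i = W i :=
  foldl_step_apply _ (fun k hk => hi k (List.mem_range.1 hk)) W

/-- The participation of a fresh (identity) row is `9`. -/
theorem sum_single_norm_sq_sq (i : Fin (N + 1)) :
    ∑ k : Fin (N + 1), (∑ a : Fin 3,
      ‖(Pi.single k (EuclideanSpace.single a (1 : ℝ)) : Fin (N + 1) → V3) i‖ ^ 2) ^ 2 = 9 := by
  have hk : ∀ k : Fin (N + 1), (∑ a : Fin 3,
      ‖(Pi.single k (EuclideanSpace.single a (1 : ℝ)) : Fin (N + 1) → V3) i‖ ^ 2) ^ 2 =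
      if i = k then 9 else 0 := by
    intro k
    by_cases hik : i = k
    · subst hik
      simp only [Pi.single_eq_same, if_true]
      have h1 : ∀ a : Fin 3, ‖(EuclideanSpace.single a (1 : ℝ) : V3)‖ ^ 2 = 1 := fun a => by simp
      simp only [h1, Finset.sum_const, Finset.card_univ, Fintype.card_fin, nsmul_eq_mul, mul_one]
      norm_num
    · simp [hik]
  simp_rw [hk]
  simp

/-- **An idle row has participation exactly `9`.** -/
theorem rowIpr_of_idle {y : Cfg N} {Δ : ℝ} {i : Fin (N + 1)} (hi : Idle σ N y Δ i) :
    rowIpr σ N y Δ i = 9 := by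
  unfold rowIpr
  simp_rw [transfer_apply_of_idle hi]
  exact sum_single_norm_sq_sq i

/-- Row participations are nonnegative. -/
theorem rowIpr_nonneg (σ : ℝ) (N : ℕ) (y : Cfg N) (Δ : ℝ) (i : Fin (N + 1)) :
    0 ≤ rowIpr σ N y Δ i :=
  Finset.sum_nonneg fun k _ => by positivity

/-- With no collision in the window the transfer is the identity and `ipr = 9` (in particular on the
Liouville-null junk sets where `collisionCount` returns `0`: Zeno orbits, overlapping data). -/
theorem ipr_eq_nine_of_colls_eq_zero {y : Cfg N} {Δ : ℝ} (h0 : colls σ N y Δ = 0) :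
    ipr σ N y Δ = 9 := by
  have hidle : ∀ i, Idle σ N y Δ i := fun i k hk => absurd hk (by rw [h0]; exact Nat.not_lt_zero k)
  unfold ipr
  simp_rw [rowIpr_of_idle (hidle _)]
  simp only [Finset.sum_const, Finset.card_univ, Fintype.card_fin, nsmul_eq_mul]
  have hN : ((N + 1 : ℕ) : ℝ) ≠ 0 := by positivity
  field_simp

/-- The number of idle particles of the window (`Nat.card`, no decidability baked in). -/
def idleCount (σ : ℝ) (N : ℕ) (y : Cfg N) (Δ : ℝ) : ℕ :=
  Nat.card {i : Fin (N + 1) // Idle σ N y Δ i}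

/-- `9 × #idle ≤ Σ_i rowIpr_i` (idle rows contribute `9`, the others are nonnegative). -/
theorem nine_mul_idleCount_le (σ : ℝ) (N : ℕ) (y : Cfg N) (Δ : ℝ) :
    9 * (idleCount σ N y Δ : ℝ) ≤ ∑ i : Fin (N + 1), rowIpr σ N y Δ i := by
  classical
  have hcount : idleCount σ N y Δ = (Finset.univ.filter fun i => Idle σ N y Δ i).card := by
    unfold idleCount
    rw [Nat.card_eq_fintype_card, Fintype.card_subtype]
  rw [hcount]
  calc 9 * ((Finset.univ.filter fun i => Idle σ N y Δ i).card : ℝ)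
        = ∑ i ∈ Finset.univ.filter (fun i => Idle σ N y Δ i), (9 : ℝ) := by
          rw [Finset.sum_const, nsmul_eq_mul, mul_comm]
    _ = ∑ i ∈ Finset.univ.filter (fun i => Idle σ N y Δ i), rowIpr σ N y Δ i :=
          Finset.sum_congr rfl fun i hi => (rowIpr_of_idle (Finset.mem_filter.1 hi).2).symm
    _ ≤ ∑ i, rowIpr σ N y Δ i :=
          Finset.sum_le_sum_of_subset_of_nonneg (Finset.filter_subset _ _)
            fun i _ _ => rowIpr_nonneg σ N y Δ i

/-- The idle fraction `#idle / (N+1) ∈ [0, 1]`. -/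
def idleFrac (σ : ℝ) (N : ℕ) (y : Cfg N) (Δ : ℝ) : ℝ :=
  (idleCount σ N y Δ : ℝ) / ((N + 1 : ℕ) : ℝ)

/-- **F3 (pointwise core, proved): `ipr ≥ 9 × (idle fraction)`.** -/
theorem nine_mul_idleFrac_le_ipr (σ : ℝ) (N : ℕ) (y : Cfg N) (Δ : ℝ) :
    9 * idleFrac σ N y Δ ≤ ipr σ N y Δ := by
  unfold idleFrac ipr
  have hN : (0 : ℝ) < ((N + 1 : ℕ) : ℝ) := by positivity
  rw [div_eq_mul_inv, mul_comm (idleCount σ N y Δ : ℝ), ← mul_assoc, mul_comm (9 : ℝ), mul_assoc]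
  exact mul_le_mul_of_nonneg_left (nine_mul_idleCount_le σ N y Δ) (inv_nonneg.2 hN.le)

end Idle

/-- FewCollisionsRare at `m = 0`, in mean: along every admissible window the local-Gibbs-evolved
expected idle fraction tends to `0`. -/
def FewIdle : Prop :=
  ∀ (a₀ θ₀ : T3 → ℝ) (u₀ : T3 → V3), Continuous a₀ → Continuous θ₀ → Continuous u₀ →
    (∀ x, 0 < a₀ x) → (∀ x, 0 < θ₀ x) →
    ∃ σ₀ : ℝ, 0 < σ₀ ∧ ∀ σ : ℝ, 0 < σ → σ < σ₀ →
      ∀ Φ : (N : ℕ) → HardSphereFlow (Torus.geometry (Fin 3)) (hsDiameter σ N) (N + 1),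
      ∀ Δ : ℕ → ℝ, (∀ N, 0 < Δ N) → Tendsto Δ atTop (𝓝 0) →
        Tendsto (fun N : ℕ => Δ N * ((N + 1 : ℕ) : ℝ) ^ ((1 : ℝ) / 3)) atTop atTop →
        ∀ t : ℝ, 0 < t →
          Tendsto (fun N : ℕ => ∫⁻ z, ENNReal.ofReal (idleFrac σ N ((Φ N).flow (t - Δ N) z) (Δ N))
            ∂(localGibbsLaw σ a₀ u₀ θ₀ N (Φ N))) atTop (𝓝 0)

/-- **F3 (proved): the crux implies FewCollisionsRare (m = 0) in mean** — any proof of the crux proves,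
in particular, that the expected fraction of collision-free particles vanishes on every admissible window,
uniformly along the non-equilibrium law; conversely an admissible window with a non-vanishing expected
idle fraction refutes the crux. -/
theorem fewIdle_of_dbi (h : DiffuseBackwardInfluence) : FewIdle := by
  rw [dbi_iff] at h
  intro a₀ θ₀ u₀ ha hθ hu ha0 hθ0
  obtain ⟨σ₀, hσ₀, hσ⟩ := h a₀ θ₀ u₀ ha hθ hu ha0 hθ0
  refine ⟨σ₀, hσ₀, fun σ hσp hσlt Φ Δ hΔp hΔ0 hΔg t ht => ?_⟩
  have hipr := hσ σ hσp hσlt Φ Δ hΔp hΔ0 hΔg t ht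
  set I : ℕ → ℝ≥0∞ := fun N => ∫⁻ z, ENNReal.ofReal (idleFrac σ N ((Φ N).flow (t - Δ N) z) (Δ N))
      ∂(localGibbsLaw σ a₀ u₀ θ₀ N (Φ N)) with hIdef
  have hle : ∀ N, 9 * I N ≤
      ∫⁻ z, ENNReal.ofReal (ipr σ N ((Φ N).flow (t - Δ N) z) (Δ N))
        ∂(localGibbsLaw σ a₀ u₀ θ₀ N (Φ N)) := by
    intro N
    simp only [hIdef]
    rw [← lintegral_const_mul' _ _ (by norm_num : (9 : ℝ≥0∞) ≠ ∞)]
    refine lintegral_mono fun z => ?_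
    rw [show (9 : ℝ≥0∞) = ENNReal.ofReal 9 by norm_num, ← ENNReal.ofReal_mul (by norm_num)]
    exact ENNReal.ofReal_le_ofReal (nine_mul_idleFrac_le_ipr _ _ _ _)
  have h9 : Tendsto (fun N => 9 * I N) atTop (𝓝 0) :=
    tendsto_of_tendsto_of_tendsto_of_le_of_le tendsto_const_nhds hipr (fun N => zero_le) hle
  have h91 : Tendsto (fun N => 9⁻¹ * (9 * I N)) atTop (𝓝 (9⁻¹ * 0)) :=
    ENNReal.Tendsto.const_mul h9 (Or.inr (ENNReal.inv_ne_top.2 (by norm_num : (9 : ℝ≥0∞) ≠ 0)))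
  rw [mul_zero] at h91
  refine h91.congr fun N => ?_
  rw [← mul_assoc, ENNReal.inv_mul_cancel (by norm_num) (by norm_num), one_mul]

/-- The crux with the growth hypothesis `Δ_N (N+1)^{1/3} → ∞` deleted (windows shorter than the mean
free time allowed). -/
def DBIWithoutGrowth : Prop :=
  ∀ (a₀ θ₀ : T3 → ℝ) (u₀ : T3 → V3), Continuous a₀ → Continuous θ₀ → Continuous u₀ →
    (∀ x, 0 < a₀ x) → (∀ x, 0 < θ₀ x) →
    ∃ σ₀ : ℝ, 0 < σ₀ ∧ ∀ σ : ℝ, 0 < σ → σ < σ₀ →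
      ∀ Φ : (N : ℕ) → HardSphereFlow (Torus.geometry (Fin 3)) (hsDiameter σ N) (N + 1),
      ∀ Δ : ℕ → ℝ, (∀ N, 0 < Δ N) → Tendsto Δ atTop (𝓝 0) →
        ∀ t : ℝ, 0 < t →
          Tendsto (fun N : ℕ => ∫⁻ z, ENNReal.ofReal (ipr σ N ((Φ N).flow (t - Δ N) z) (Δ N))
            ∂(localGibbsLaw σ a₀ u₀ θ₀ N (Φ N))) atTop (𝓝 0)

/-- The canonical (homogeneous, at rest, unit temperature) Gibbs law: `localGibbsLaw` with constant profiles. -/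
def eqLaw (σ : ℝ) (N : ℕ)
    (Φ : HardSphereFlow (Torus.geometry (Fin 3)) (hsDiameter σ N) (N + 1)) : Measure (Cfg N) :=
  localGibbsLaw σ (fun _ => 1) (fun _ => 0) (fun _ => 1) N Φ

/-- HYPOTHESIS (EqInvariant, the routes' stub): the canonical Gibbs law is invariant under every flow map. -/
def EqInvariantH (σ : ℝ) : Prop :=
  ∀ (N : ℕ) (Φ : HardSphereFlow (Torus.geometry (Fin 3)) (hsDiameter σ N) (N + 1)) (s : ℝ),
    MeasurePreserving (Φ.flow s) (eqLaw σ N Φ) (eqLaw σ N Φ)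

/-- HYPOTHESIS (contact-intensity bound, in the form used): under the canonical Gibbs law the expected idle
fraction over a window of length `Δ ≤ 1` is at least `1 − C (N+1)^{1/3} Δ` (a tagged sphere of diameter
`σ (N+1)^{-1/3}` among `N + 1` expects `≤ C σ² (N+1)^{1/3} Δ` collisions in `[0, Δ]`: special-flow
representation of the collision intensity, CIP 1994 App. 4.A; contact value `g₂(ε⁺)` bounded at `σ < 1/2`;
also forces total mass `1`). Not in the tree. -/
def IdleIntensityH (σ : ℝ) : Prop :=
  ∃ C : ℝ, ∀ (N : ℕ) (Φ : HardSphereFlow (Torus.geometry (Fin 3)) (hsDiameter σ N) (N + 1)) (Δ : ℝ),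
    0 < Δ → Δ ≤ 1 →
      ENNReal.ofReal (1 - C * ((N + 1 : ℕ) : ℝ) ^ ((1 : ℝ) / 3) * Δ) ≤
        ∫⁻ y, ENNReal.ofReal (idleFrac σ N y Δ) ∂(eqLaw σ N Φ)

/-- **F3 (proved modulo two named hypotheses): `DBIWithoutGrowth` is FALSE** — the growth hypothesis
`Δ_N (N+1)^{1/3} → ∞` is load-bearing. Witness: constant profiles `(1, 0, 1)`, the Alexander flow
(`HardSphereFlow.nonempty_torus_holds`, in the tree), the sub-mean-free-time window
`Δ_N = (N+1)^{-1/3} (N+1)^{-1}` (`> 0`, `→ 0`, but `Δ_N (N+1)^{1/3} = (N+1)^{-1} → 0`), `t = 1`: by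
`nine_mul_idleFrac_le_ipr`, `lintegral_map_le` and invariance, `E[ipr] ≥ 9 E_G[idleFrac] ≥ 9 (1 − C/(N+1)) → 9`,
contradicting `→ 0`. Remaining hypotheses, both standard and both absent from the tree: `EqInvariantH`
(Liouville + energy conservation; the lines' `stub_eqInvariant`) and `IdleIntensityH` (collision intensity of a
tagged sphere under the canonical law). -/
theorem dbiWithoutGrowth_false_of (hinv : ∀ σ : ℝ, 0 < σ → σ < 1 / 2 → EqInvariantH σ)
    (hidle : ∀ σ : ℝ, 0 < σ → σ < 1 / 2 → IdleIntensityH σ) : ¬ DBIWithoutGrowth := by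
  intro h
  obtain ⟨σ₀, hσ₀, hσ⟩ := h (fun _ => 1) (fun _ => 1) (fun _ => 0) continuous_const continuous_const
    continuous_const (fun _ => one_pos) (fun _ => one_pos)
  -- a reduced density below both thresholds
  set σ : ℝ := min (σ₀ / 2) (1 / 4) with hσdef
  have hσp : 0 < σ := lt_min (by linarith) (by norm_num)
  have hσlt : σ < σ₀ := (min_le_left _ _).trans_lt (by linarith)
  have hσh : σ < 1 / 2 := (min_le_right _ _).trans_lt (by norm_num)
  -- the Alexander flow (Alexander's theorem is a theorem of the tree)
  have hflow : ∀ N : ℕ, Nonempty (HardSphereFlow (Torus.geometry (Fin 3)) (hsDiameter σ N) (N + 1)) :=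
    fun N => HardSphereFlow.nonempty_torus_holds (d := Fin 3) (hsDiameter_pos hσp N)
      ((hsDiameter_le hσp.le N).trans_lt (by rw [inv_eq_one_div]; exact hσh)) (N + 1)
  let Φ : (N : ℕ) → HardSphereFlow (Torus.geometry (Fin 3)) (hsDiameter σ N) (N + 1) :=
    fun N => (hflow N).some
  obtain ⟨C', hC⟩ := hidle σ hσp hσh
  -- the sub-mean-free-time window Δ_N = (N+1)^{-1/3} (N+1)^{-1}
  have hr : ∀ N : ℕ, 1 ≤ ((N + 1 : ℕ) : ℝ) ^ ((1 : ℝ) / 3) := fun N =>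
    Real.one_le_rpow (by exact_mod_cast Nat.succ_pos N) (by norm_num)
  have hrpos : ∀ N : ℕ, 0 < ((N + 1 : ℕ) : ℝ) ^ ((1 : ℝ) / 3) := fun N => one_pos.trans_le (hr N)
  let Δ : ℕ → ℝ := fun N => (((N + 1 : ℕ) : ℝ) ^ ((1 : ℝ) / 3))⁻¹ * (1 / ((N : ℝ) + 1))
  have hN1 : ∀ N : ℕ, (0 : ℝ) < (N : ℝ) + 1 := fun N => by positivity
  have hΔp : ∀ N : ℕ, 0 < Δ N := fun N => mul_pos (inv_pos.2 (hrpos N)) (one_div_pos.2 (hN1 N))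
  have hΔle : ∀ N : ℕ, Δ N ≤ 1 / ((N : ℝ) + 1) := fun N => by
    have h1 : (((N + 1 : ℕ) : ℝ) ^ ((1 : ℝ) / 3))⁻¹ ≤ 1 := inv_le_one_of_one_le₀ (hr N)
    calc Δ N = (((N + 1 : ℕ) : ℝ) ^ ((1 : ℝ) / 3))⁻¹ * (1 / ((N : ℝ) + 1)) := rfl
      _ ≤ 1 * (1 / ((N : ℝ) + 1)) :=
          mul_le_mul_of_nonneg_right h1 (one_div_pos.2 (hN1 N)).le
      _ = 1 / ((N : ℝ) + 1) := one_mul _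
  have hΔle1 : ∀ N : ℕ, Δ N ≤ 1 := fun N => (hΔle N).trans (by
    rw [div_le_one (hN1 N)]; linarith [(Nat.cast_nonneg N : (0 : ℝ) ≤ N)])
  have hΔ0 : Tendsto Δ atTop (𝓝 0) :=
    tendsto_of_tendsto_of_tendsto_of_le_of_le tendsto_const_nhds tendsto_one_div_add_atTop_nhds_zero_nat
      (fun N => (hΔp N).le) hΔle
  have hrΔ : ∀ N : ℕ, C' * ((N + 1 : ℕ) : ℝ) ^ ((1 : ℝ) / 3) * Δ N = C' * (1 / ((N : ℝ) + 1)) := by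
    intro N
    show C' * ((N + 1 : ℕ) : ℝ) ^ ((1 : ℝ) / 3) *
        ((((N + 1 : ℕ) : ℝ) ^ ((1 : ℝ) / 3))⁻¹ * (1 / ((N : ℝ) + 1))) = C' * (1 / ((N : ℝ) + 1))
    rw [← mul_assoc, mul_assoc C', mul_inv_cancel₀ (hrpos N).ne', mul_one]
  -- the crux without growth, applied
  have hT := hσ σ hσp hσlt Φ Δ hΔp hΔ0 1 one_pos
  -- lower bound: E[ipr ∘ Φ_{1-Δ}] ≥ 9 E_G[idleFrac] ≥ 9 (1 - C'/(N+1))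
  have hlow : ∀ N : ℕ, 9 * ENNReal.ofReal (1 - C' * (1 / ((N : ℝ) + 1))) ≤
      ∫⁻ z, ENNReal.ofReal (ipr σ N ((Φ N).flow (1 - Δ N) z) (Δ N))
        ∂(localGibbsLaw σ (fun _ => 1) (fun _ => 0) (fun _ => 1) N (Φ N)) := by
    intro N
    have hmap : Measure.map ((Φ N).flow (1 - Δ N)) (eqLaw σ N (Φ N)) = eqLaw σ N (Φ N) :=
      (hinv σ hσp hσh N (Φ N) (1 - Δ N)).map_eq
    have h1 : 9 * ENNReal.ofReal (1 - C' * (1 / ((N : ℝ) + 1))) ≤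
        9 * ∫⁻ y, ENNReal.ofReal (idleFrac σ N y (Δ N)) ∂(eqLaw σ N (Φ N)) := by
      have h0 := hC N (Φ N) (Δ N) (hΔp N) (hΔle1 N)
      rw [hrΔ N] at h0
      gcongr
    have h2 : 9 * ∫⁻ y, ENNReal.ofReal (idleFrac σ N y (Δ N)) ∂(eqLaw σ N (Φ N)) =
        ∫⁻ y, ENNReal.ofReal (9 * idleFrac σ N y (Δ N)) ∂(eqLaw σ N (Φ N)) := by
      rw [← lintegral_const_mul' _ _ (by norm_num : (9 : ℝ≥0∞) ≠ ∞)]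
      refine lintegral_congr fun y => ?_
      rw [show (9 : ℝ≥0∞) = ENNReal.ofReal 9 by norm_num, ← ENNReal.ofReal_mul (by norm_num)]
    have h3 : ∫⁻ y, ENNReal.ofReal (9 * idleFrac σ N y (Δ N)) ∂(eqLaw σ N (Φ N)) ≤
        ∫⁻ z, ENNReal.ofReal (9 * idleFrac σ N ((Φ N).flow (1 - Δ N) z) (Δ N)) ∂(eqLaw σ N (Φ N)) := by
      conv_lhs => rw [← hmap]
      exact lintegral_map_le _ _
    have h4 : ∫⁻ z, ENNReal.ofReal (9 * idleFrac σ N ((Φ N).flow (1 - Δ N) z) (Δ N)) ∂(eqLaw σ N (Φ N)) ≤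
        ∫⁻ z, ENNReal.ofReal (ipr σ N ((Φ N).flow (1 - Δ N) z) (Δ N)) ∂(eqLaw σ N (Φ N)) :=
      lintegral_mono fun z => ENNReal.ofReal_le_ofReal (nine_mul_idleFrac_le_ipr _ _ _ _)
    exact h1.trans (h2.le.trans (h3.trans h4))
  -- the lower bound tends to 9
  have hlim : Tendsto (fun N : ℕ => 9 * ENNReal.ofReal (1 - C' * (1 / ((N : ℝ) + 1)))) atTop (𝓝 9) := by
    have h1 : Tendsto (fun N : ℕ => 1 - C' * (1 / ((N : ℝ) + 1))) atTop (𝓝 1) := by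
      have := (tendsto_one_div_add_atTop_nhds_zero_nat.const_mul C').const_sub 1
      simpa using this
    have h2 : Tendsto (fun N : ℕ => ENNReal.ofReal (1 - C' * (1 / ((N : ℝ) + 1)))) atTop (𝓝 1) := by
      have := ENNReal.tendsto_ofReal h1
      rwa [ENNReal.ofReal_one] at this
    have h3 := ENNReal.Tendsto.const_mul h2 (Or.inl one_ne_zero) (a := 9)
    simpa using h3
  have h9 : (9 : ℝ≥0∞) ≤ 0 := le_of_tendsto_of_tendsto hlim hT (Eventually.of_forall hlow)
  exact absurd h9 (by norm_num)

/-! ## §4 (F4) The fold step is an involution: no pathwise monotone functional -/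

section Echo

variable {σ : ℝ} {N : ℕ}

/-- **F4 (proved): the crux's fold step is an involution.** Reflecting the same pair at the same
pre-collisional snapshot twice restores every velocity: `step k ∘ step k = id`. Hence no functional of the
transfer (in particular no row participation) is monotone along arbitrary reflection sequences — the
Loschmidt echo `R_1⋯R_L R_L⋯R_1 = I` in its shortest form. Delocalisation must come from the law of the
realised sequence, not from reflection algebra. -/
theorem step_step (y : Cfg N) (W : Fin (N + 1) → V3) (k : ℕ) :
    step σ N y (step σ N y W k) k = W := by
  unfold step
  by_cases h : (pairsAt σ N y k).Nonempty
  · rw [dif_pos h, dif_pos h]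
    have hne : h.some.1 ≠ h.some.2 := ne_of_lt (Alexander.mem_incomingPairs.1 h.some_mem).1
    set z : Cfg N := fun j => ((pre σ N y k j).1, W j) with hz
    have hcfg : (fun j => ((pre σ N y k j).1,
        (collidePair (Torus.geometry (Fin 3)) h.some.1 h.some.2 z j).2)) =
        collidePair (Torus.geometry (Fin 3)) h.some.1 h.some.2 z := by
      funext j
      have h1 : (collidePair (Torus.geometry (Fin 3)) h.some.1 h.some.2 z j).1 = (pre σ N y k j).1 := by
        rw [collidePair_apply_fst]
      rw [← h1]
    funext i
    rw [hcfg, collidePair_collidePair hne]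
  · rw [dif_neg h, dif_neg h]

end Echo

/-! ## §5 (F5) Planar realised normals: a conserved component, `ipr ≥ 1` for ever -/

section Planar

variable {σ : ℝ} {N : ℕ}

/-- The realised (unnormalised, minimal-image) normal of the `k`-th fold step (`0` if the step reflects
nothing). -/
def normalAt (σ : ℝ) (N : ℕ) (y : Cfg N) (k : ℕ) : V3 :=
  @dite V3 (pairsAt σ N y k).Nonempty (Classical.propDecidable _)
    (fun h => (Torus.geometry (Fin 3)).sepVec (pre σ N y k h.some.1).1 (pre σ N y k h.some.2).1)
    (fun _ => 0)

/-- A reflection at a normal orthogonal to `e` preserves every `e`-component. -/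
theorem inner_reflectVel_of_orth {n e : V3} (hn : ⟪n, e⟫_ℝ = 0) (v w : V3) :
    ⟪(reflectVel n (v, w)).1, e⟫_ℝ = ⟪v, e⟫_ℝ ∧ ⟪(reflectVel n (v, w)).2, e⟫_ℝ = ⟪w, e⟫_ℝ := by
  simp [reflectVel, inner_sub_left, inner_add_left, inner_smul_left, hn]

/-- A fold step whose realised normal is orthogonal to `e` preserves every particle's `e`-component. -/
theorem inner_step_of_orth {y : Cfg N} {k : ℕ} {e : V3} (hk : ⟪normalAt σ N y k, e⟫_ℝ = 0)
    (W : Fin (N + 1) → V3) (i : Fin (N + 1)) : ⟪step σ N y W k i, e⟫_ℝ = ⟪W i, e⟫_ℝ := by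
  unfold step
  by_cases h : (pairsAt σ N y k).Nonempty
  · rw [dif_pos h]
    have hn : ⟪(Torus.geometry (Fin 3)).sepVec (pre σ N y k h.some.1).1 (pre σ N y k h.some.2).1,
        e⟫_ℝ = 0 := by
      simpa [normalAt, dif_pos h] using hk
    have hne : h.some.1 ≠ h.some.2 := ne_of_lt (Alexander.mem_incomingPairs.1 h.some_mem).1
    by_cases hi1 : i = h.some.1
    · rw [hi1, collidePair_apply_left hne]
      exact (inner_reflectVel_of_orth hn _ _).1
    by_cases hi2 : i = h.some.2
    · rw [hi2, collidePair_apply_right]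
      exact (inner_reflectVel_of_orth hn _ _).2
    rw [collidePair_apply_of_ne hi1 hi2]
  · rw [dif_neg h]

/-- Planar window: every realised normal of the window is orthogonal to `e`. -/
def PlanarWindow (σ : ℝ) (N : ℕ) (y : Cfg N) (Δ : ℝ) (e : V3) : Prop :=
  ∀ k < colls σ N y Δ, ⟪normalAt σ N y k, e⟫_ℝ = 0

/-- **F5 (proved): on a planar window the `e`-components of all velocities are invariants of the
transfer.** -/
theorem inner_transfer_of_planar {y : Cfg N} {Δ : ℝ} {e : V3} (hP : PlanarWindow σ N y Δ e)
    (W : Fin (N + 1) → V3) (i : Fin (N + 1)) : ⟪transfer σ N y Δ W i, e⟫_ℝ = ⟪W i, e⟫_ℝ := by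
  unfold transfer
  have key : ∀ L : List ℕ, (∀ k ∈ L, ⟪normalAt σ N y k, e⟫_ℝ = 0) → ∀ W : Fin (N + 1) → V3,
      ⟪(L.foldl (step σ N y) W) i, e⟫_ℝ = ⟪W i, e⟫_ℝ := by
    intro L hL
    induction L with
    | nil => intro W; rfl
    | cons k L ih =>
      intro W
      rw [List.foldl_cons, ih (fun k' hk' => hL k' (List.mem_cons_of_mem _ hk')),
        inner_step_of_orth (hL k List.mem_cons_self)]
  exact key _ (fun k hk => hP k (List.mem_range.1 hk)) W

/-- **F5 (proved): on a window whose realised normals are all orthogonal to the coordinate direction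
`e_c`, EVERY row keeps participation `≥ 1`** — however many collisions the window carries. So
"`n_N → ∞` collisions per particle" does not imply delocalisation without non-degeneracy (3-D spread) of the
realised normals: the pointwise strengthening `ipr_i ≤ f(#own collisions) → 0` is false. -/
theorem one_le_rowIpr_of_planar {y : Cfg N} {Δ : ℝ} (c : Fin 3)
    (hP : PlanarWindow σ N y Δ (EuclideanSpace.single c (1 : ℝ))) (i : Fin (N + 1)) :
    1 ≤ rowIpr σ N y Δ i := by
  -- the (k, a) = (i, c) entry alone is ≥ 1: its `e_c`-component is conserved and equals 1
  have hnorm_e : ‖(EuclideanSpace.single c (1 : ℝ) : V3)‖ = 1 := by simp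
  have hentry : 1 ≤ ‖transfer σ N y Δ (Pi.single i (EuclideanSpace.single c (1 : ℝ))) i‖ ^ 2 := by
    have hinner : ⟪transfer σ N y Δ (Pi.single i (EuclideanSpace.single c (1 : ℝ))) i,
        (EuclideanSpace.single c (1 : ℝ) : V3)⟫_ℝ = 1 := by
      rw [inner_transfer_of_planar hP, Pi.single_eq_same]
      simp
    have hcs := abs_real_inner_le_norm
      (transfer σ N y Δ (Pi.single i (EuclideanSpace.single c (1 : ℝ))) i)
      (EuclideanSpace.single c (1 : ℝ) : V3)
    rw [hinner, hnorm_e, mul_one, abs_one] at hcs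
    nlinarith [norm_nonneg (transfer σ N y Δ (Pi.single i (EuclideanSpace.single c (1 : ℝ))) i)]
  let g : Fin (N + 1) → Fin 3 → ℝ := fun k a =>
    ‖transfer σ N y Δ (Pi.single k (EuclideanSpace.single a (1 : ℝ))) i‖ ^ 2
  have hg : ∀ k a, 0 ≤ g k a := fun k a => sq_nonneg _
  have hrow : 1 ≤ ∑ a : Fin 3, g i a :=
    calc (1 : ℝ) ≤ g i c := hentry
      _ ≤ ∑ a : Fin 3, g i a := Finset.single_le_sum (fun a _ => hg i a) (Finset.mem_univ c)
  have hsq : 1 ≤ (∑ a : Fin 3, g i a) ^ 2 := one_le_pow₀ hrow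
  have hfin : (∑ a : Fin 3, g i a) ^ 2 ≤ ∑ k : Fin (N + 1), (∑ a : Fin 3, g k a) ^ 2 :=
    Finset.single_le_sum (f := fun k => (∑ a : Fin 3, g k a) ^ 2) (fun k _ => sq_nonneg _)
      (Finset.mem_univ i)
  change 1 ≤ ∑ k : Fin (N + 1), (∑ a : Fin 3, g k a) ^ 2
  exact hsq.trans hfin

/-- **F5 (proved): planar windows keep the mean participation `≥ 1`.** -/
theorem one_le_ipr_of_planar {y : Cfg N} {Δ : ℝ} (c : Fin 3)
    (hP : PlanarWindow σ N y Δ (EuclideanSpace.single c (1 : ℝ))) : 1 ≤ ipr σ N y Δ := by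
  unfold ipr
  have hN : (0 : ℝ) < ((N + 1 : ℕ) : ℝ) := by positivity
  have hsum : ((N + 1 : ℕ) : ℝ) ≤ ∑ i : Fin (N + 1), rowIpr σ N y Δ i := by
    have h1 : ∑ _i : Fin (N + 1), (1 : ℝ) = ((N + 1 : ℕ) : ℝ) := by
      rw [Finset.sum_const, Finset.card_univ, Fintype.card_fin, nsmul_eq_mul, mul_one]
    rw [← h1]
    exact Finset.sum_le_sum fun i _ => one_le_rowIpr_of_planar c hP i
  have hkey : ((N + 1 : ℕ) : ℝ)⁻¹ * ((N + 1 : ℕ) : ℝ) = 1 := inv_mul_cancel₀ hN.ne'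
  calc (1 : ℝ) = ((N + 1 : ℕ) : ℝ)⁻¹ * ((N + 1 : ℕ) : ℝ) := hkey.symm
    _ ≤ ((N + 1 : ℕ) : ℝ)⁻¹ * ∑ i : Fin (N + 1), rowIpr σ N y Δ i :=
        mul_le_mul_of_nonneg_left hsum (inv_nonneg.2 hN.le)

end Planar


/-! ## §6 (F7) Free directions: a particle's velocity changes only along its OWN collision normals -/

section FreeDirection

variable {σ : ℝ} {N : ℕ}

/-- Step `k` *spares* the direction `e` at particle `i`: either it does not touch `i`, or its realised normal
is orthogonal to `e`. -/
def Spares (σ : ℝ) (N : ℕ) (y : Cfg N) (k : ℕ) (i : Fin (N + 1)) (e : V3) : Prop :=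
  (∀ h : (pairsAt σ N y k).Nonempty, i ≠ h.some.1 ∧ i ≠ h.some.2) ∨ ⟪normalAt σ N y k, e⟫_ℝ = 0

/-- A sparing step preserves the `e`-component of particle `i`'s velocity. -/
theorem inner_step_of_spares {y : Cfg N} {k : ℕ} {i : Fin (N + 1)} {e : V3}
    (hk : Spares σ N y k i e) (W : Fin (N + 1) → V3) : ⟪step σ N y W k i, e⟫_ℝ = ⟪W i, e⟫_ℝ := by
  rcases hk with hk | hk
  · rw [step_apply_of_ne hk]
  · exact inner_step_of_orth hk W i

/-- **F7 (proved): `v_i` changes only along `i`'s own collision normals.** If every step of the window that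
touches `i` has its realised normal orthogonal to `e`, the `e`-component of particle `i`'s output is the
`e`-component of its input — for EVERY input field (this is `Π_{V} M_ii = Π_V`, `Π_V M_ik = 0` for `k ≠ i`,
`V = (own normals)ᗮ`). Generalises both the idle-row lemma (no own step) and the planar kernel (all normals ⊥ e). -/
theorem inner_transfer_of_spares {y : Cfg N} {Δ : ℝ} {i : Fin (N + 1)} {e : V3}
    (hS : ∀ k < colls σ N y Δ, Spares σ N y k i e) (W : Fin (N + 1) → V3) :
    ⟪transfer σ N y Δ W i, e⟫_ℝ = ⟪W i, e⟫_ℝ := by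
  unfold transfer
  have key : ∀ L : List ℕ, (∀ k ∈ L, Spares σ N y k i e) → ∀ W : Fin (N + 1) → V3,
      ⟪(L.foldl (step σ N y) W) i, e⟫_ℝ = ⟪W i, e⟫_ℝ := by
    intro L hL
    induction L with
    | nil => intro W; rfl
    | cons k L ih =>
      intro W
      rw [List.foldl_cons, ih (fun k' hk' => hL k' (List.mem_cons_of_mem _ hk')),
        inner_step_of_spares (hL k List.mem_cons_self)]
  exact key _ (fun k hk => hS k (List.mem_range.1 hk)) W

/-- **F7 (proved): a free unit direction keeps the self-block heavy: `rowIpr_i ≥ 1`.** If some unit vector `e`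
is orthogonal to the realised normals of all steps touching `i` (automatic when `i` has at most two own
collisions in the window: two vectors never span `ℝ³`), then `a_ii = ‖M_ii‖_F² ≥ Σ_a ⟪M_ii e_a, e⟫² = ‖e‖² = 1`
and `rowIpr_i ≥ a_ii² ≥ 1`. Consequence: the crux forces the expected fraction of particles with `≤ 2`
collisions in the window to vanish (FewCollisionsRare for `m ≤ 2` is NECESSARY); the bound is tight at three
orthonormal own normals with fresh partners (`a_ii = 0`). -/
theorem one_le_rowIpr_of_free_direction {y : Cfg N} {Δ : ℝ} (i : Fin (N + 1)) {e : V3} (he : ‖e‖ = 1)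
    (hS : ∀ k < colls σ N y Δ, Spares σ N y k i e) : 1 ≤ rowIpr σ N y Δ i := by
  -- a_ii ≥ Σ_a ⟪M_ii e_a, e⟫² = Σ_a (e a)² = 1
  let g : Fin (N + 1) → Fin 3 → ℝ := fun k a =>
    ‖transfer σ N y Δ (Pi.single k (EuclideanSpace.single a (1 : ℝ))) i‖ ^ 2
  have hg : ∀ k a, 0 ≤ g k a := fun k a => sq_nonneg _
  have hcomp : ∀ a : Fin 3, (e a) ^ 2 ≤ g i a := by
    intro a
    have hinner : ⟪transfer σ N y Δ (Pi.single i (EuclideanSpace.single a (1 : ℝ))) i, e⟫_ℝ = e a := by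
      rw [inner_transfer_of_spares hS, Pi.single_eq_same]
      simp [EuclideanSpace.inner_single_left]
    have hcs := abs_real_inner_le_norm
      (transfer σ N y Δ (Pi.single i (EuclideanSpace.single a (1 : ℝ))) i) e
    rw [hinner, he, mul_one] at hcs
    have h0 : 0 ≤ ‖transfer σ N y Δ (Pi.single i (EuclideanSpace.single a (1 : ℝ))) i‖ := norm_nonneg _
    calc (e a) ^ 2 = |e a| ^ 2 := (sq_abs _).symm
      _ ≤ ‖transfer σ N y Δ (Pi.single i (EuclideanSpace.single a (1 : ℝ))) i‖ ^ 2 :=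
          pow_le_pow_left₀ (abs_nonneg _) hcs 2
  have hnorm : ∑ a : Fin 3, (e a) ^ 2 = 1 := by
    have h2 := EuclideanSpace.norm_eq e
    rw [he] at h2
    have h3 : ∑ a : Fin 3, ‖e a‖ ^ 2 = 1 := by
      have := congrArg (fun x : ℝ => x ^ 2) h2
      simp only [one_pow] at this
      rw [Real.sq_sqrt (Finset.sum_nonneg fun a _ => by positivity)] at this
      exact this.symm
    simpa [Real.norm_eq_abs, sq_abs] using h3
  have hrow : 1 ≤ ∑ a : Fin 3, g i a := by
    rw [← hnorm]
    exact Finset.sum_le_sum fun a _ => hcomp a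
  have hsq : 1 ≤ (∑ a : Fin 3, g i a) ^ 2 := one_le_pow₀ hrow
  have hfin : (∑ a : Fin 3, g i a) ^ 2 ≤ ∑ k : Fin (N + 1), (∑ a : Fin 3, g k a) ^ 2 :=
    Finset.single_le_sum (f := fun k => (∑ a : Fin 3, g k a) ^ 2) (fun k _ => sq_nonneg _)
      (Finset.mem_univ i)
  change 1 ≤ ∑ k : Fin (N + 1), (∑ a : Fin 3, g k a) ^ 2
  exact hsq.trans hfin

/-- At most two steps of the window touch particle `i` (own-collision count `≤ 2`). -/
def OwnLeTwo (σ : ℝ) (N : ℕ) (y : Cfg N) (Δ : ℝ) (i : Fin (N + 1)) : Prop :=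
  ∃ k₁ k₂ : ℕ, ∀ k < colls σ N y Δ, ∀ h : (pairsAt σ N y k).Nonempty,
    (i = h.some.1 ∨ i = h.some.2) → (k = k₁ ∨ k = k₂)

/-- Two vectors of `ℝ³` have a common unit normal. -/
theorem exists_unit_orth_two (u v : V3) : ∃ e : V3, ‖e‖ = 1 ∧ ⟪u, e⟫_ℝ = 0 ∧ ⟪v, e⟫_ℝ = 0 := by
  set U : Submodule ℝ V3 := Submodule.span ℝ ({u, v} : Set V3) with hUdef
  have hU : Module.finrank ℝ U ≤ 2 := by
    have h := finrank_span_finset_le_card (R := ℝ) (M := V3) ({u, v} : Finset V3)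
    rw [Finset.coe_pair] at h
    exact h.trans Finset.card_le_two
  have hperp : 0 < Module.finrank ℝ Uᗮ := by
    have h := Submodule.finrank_add_finrank_orthogonal U
    have h3 : Module.finrank ℝ V3 = 3 := by simp
    omega
  have hne : Uᗮ ≠ ⊥ := by
    intro hbot
    rw [hbot, finrank_bot] at hperp
    exact lt_irrefl 0 hperp
  obtain ⟨e, heU, hne0⟩ := Submodule.exists_mem_ne_zero_of_ne_bot hne
  have hnorm : ‖e‖ ≠ 0 := norm_ne_zero_iff.2 hne0
  have hu : u ∈ U := Submodule.subset_span (by simp)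
  have hv : v ∈ U := Submodule.subset_span (by simp)
  refine ⟨‖e‖⁻¹ • e, ?_, ?_, ?_⟩
  · rw [norm_smul, norm_inv, norm_norm, inv_mul_cancel₀ hnorm]
  · rw [inner_smul_right, Submodule.inner_right_of_mem_orthogonal hu heU, mul_zero]
  · rw [inner_smul_right, Submodule.inner_right_of_mem_orthogonal hv heU, mul_zero]

/-- **F7 (proved): particles with at most two collisions in the window keep `rowIpr ≥ 1`.** -/
theorem one_le_rowIpr_of_ownLeTwo {y : Cfg N} {Δ : ℝ} {i : Fin (N + 1)} (h2 : OwnLeTwo σ N y Δ i) :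
    1 ≤ rowIpr σ N y Δ i := by
  obtain ⟨k₁, k₂, hk⟩ := h2
  obtain ⟨e, he, h1, h2'⟩ := exists_unit_orth_two (normalAt σ N y k₁) (normalAt σ N y k₂)
  refine one_le_rowIpr_of_free_direction i he fun k hkc => ?_
  by_cases hown : ∀ h : (pairsAt σ N y k).Nonempty, i ≠ h.some.1 ∧ i ≠ h.some.2
  · exact Or.inl hown
  · right
    obtain ⟨h, hh⟩ := not_forall.1 hown
    have hor : i = h.some.1 ∨ i = h.some.2 := by
      by_cases hi1 : i = h.some.1
      · exact Or.inl hi1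
      by_cases hi2 : i = h.some.2
      · exact Or.inr hi2
      · exact absurd ⟨hi1, hi2⟩ hh
    rcases hk k hkc h hor with rfl | rfl
    · exact h1
    · exact h2'

/-- The number of particles with at most two own collisions in the window. -/
def lowCollCount (σ : ℝ) (N : ℕ) (y : Cfg N) (Δ : ℝ) : ℕ :=
  Nat.card {i : Fin (N + 1) // OwnLeTwo σ N y Δ i}

/-- The fraction of particles with at most two own collisions in the window. -/
def lowCollFrac (σ : ℝ) (N : ℕ) (y : Cfg N) (Δ : ℝ) : ℝ :=
  (lowCollCount σ N y Δ : ℝ) / ((N + 1 : ℕ) : ℝ)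

/-- `#{i : ≤ 2 own collisions} ≤ Σ_i rowIpr_i`. -/
theorem lowCollCount_le (σ : ℝ) (N : ℕ) (y : Cfg N) (Δ : ℝ) :
    (lowCollCount σ N y Δ : ℝ) ≤ ∑ i : Fin (N + 1), rowIpr σ N y Δ i := by
  classical
  have hcount : lowCollCount σ N y Δ = (Finset.univ.filter fun i => OwnLeTwo σ N y Δ i).card := by
    unfold lowCollCount
    rw [Nat.card_eq_fintype_card, ← Fintype.card_subtype]
  rw [hcount]
  calc ((Finset.univ.filter fun i => OwnLeTwo σ N y Δ i).card : ℝ)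
        = ∑ i ∈ Finset.univ.filter (fun i => OwnLeTwo σ N y Δ i), (1 : ℝ) := by
          rw [Finset.sum_const, nsmul_eq_mul, mul_one]
    _ ≤ ∑ i ∈ Finset.univ.filter (fun i => OwnLeTwo σ N y Δ i), rowIpr σ N y Δ i :=
          Finset.sum_le_sum fun i hi => one_le_rowIpr_of_ownLeTwo (Finset.mem_filter.1 hi).2
    _ ≤ ∑ i, rowIpr σ N y Δ i :=
          Finset.sum_le_sum_of_subset_of_nonneg (Finset.filter_subset _ _)
            fun i _ _ => rowIpr_nonneg σ N y Δ i

/-- **F7 (pointwise core, proved): `ipr ≥` fraction of particles with `≤ 2` own collisions.** -/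
theorem lowCollFrac_le_ipr (σ : ℝ) (N : ℕ) (y : Cfg N) (Δ : ℝ) :
    lowCollFrac σ N y Δ ≤ ipr σ N y Δ := by
  unfold lowCollFrac ipr
  have hN : (0 : ℝ) < ((N + 1 : ℕ) : ℝ) := by positivity
  rw [div_eq_mul_inv, mul_comm]
  exact mul_le_mul_of_nonneg_left (lowCollCount_le σ N y Δ) (inv_nonneg.2 hN.le)

/-- FewCollisionsRare for `m ≤ 2`, in mean: along every admissible window the local-Gibbs-evolved expected
fraction of particles with at most two collisions in the window tends to `0`. -/
def FewLowColl : Prop :=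
  ∀ (a₀ θ₀ : T3 → ℝ) (u₀ : T3 → V3), Continuous a₀ → Continuous θ₀ → Continuous u₀ →
    (∀ x, 0 < a₀ x) → (∀ x, 0 < θ₀ x) →
    ∃ σ₀ : ℝ, 0 < σ₀ ∧ ∀ σ : ℝ, 0 < σ → σ < σ₀ →
      ∀ Φ : (N : ℕ) → HardSphereFlow (Torus.geometry (Fin 3)) (hsDiameter σ N) (N + 1),
      ∀ Δ : ℕ → ℝ, (∀ N, 0 < Δ N) → Tendsto Δ atTop (𝓝 0) →
        Tendsto (fun N : ℕ => Δ N * ((N + 1 : ℕ) : ℝ) ^ ((1 : ℝ) / 3)) atTop atTop →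
        ∀ t : ℝ, 0 < t →
          Tendsto (fun N : ℕ => ∫⁻ z, ENNReal.ofReal (lowCollFrac σ N ((Φ N).flow (t - Δ N) z) (Δ N))
            ∂(localGibbsLaw σ a₀ u₀ θ₀ N (Φ N))) atTop (𝓝 0)

/-- **F7 (proved): the crux implies FewCollisionsRare for `m ≤ 2` in mean** (strengthens `fewIdle_of_dbi`):
any proof of the crux proves that the expected fraction of particles suffering at most two collisions in the
window vanishes, on every admissible window, along the non-equilibrium law. -/
theorem fewLowColl_of_dbi (h : DiffuseBackwardInfluence) : FewLowColl := by
  rw [dbi_iff] at h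
  intro a₀ θ₀ u₀ ha hθ hu ha0 hθ0
  obtain ⟨σ₀, hσ₀, hσ⟩ := h a₀ θ₀ u₀ ha hθ hu ha0 hθ0
  refine ⟨σ₀, hσ₀, fun σ hσp hσlt Φ Δ hΔp hΔ0 hΔg t ht => ?_⟩
  have hipr := hσ σ hσp hσlt Φ Δ hΔp hΔ0 hΔg t ht
  refine tendsto_of_tendsto_of_tendsto_of_le_of_le tendsto_const_nhds hipr (fun N => zero_le) fun N => ?_
  exact lintegral_mono fun z => ENNReal.ofReal_le_ofReal (lowCollFrac_le_ipr _ _ _ _)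

end FreeDirection


/-! ## §7 (F8) Tightness of `a_ii ≥ 3 − m_i`: three fresh coordinate collisions empty the self-block (model) -/

section Tightness

/-- Model fold step: the crux's fold body with the pre-collisional positions replaced by the Euclidean snapshot
`x_{p.1} = nrm`, `x_j = 0` otherwise (separation vector `nrm`). -/
def mstep {n : ℕ} (p : Fin n × Fin n) (nrm : V3) (W : Fin n → V3) : Fin n → V3 :=
  fun i => (collidePair (Euclidean.geometry (Fin 3)) p.1 p.2 (fun j => ((Pi.single p.1 nrm : Fin n → V3) j, W j)) i).2

theorem reflectVel_coordinate (b : Fin 3) (v w : V3) :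
    reflectVel (EuclideanSpace.single b (1 : ℝ)) (v, w) =
      (v - (v b - w b) • EuclideanSpace.single b (1 : ℝ),
        w + (v b - w b) • EuclideanSpace.single b (1 : ℝ)) := by
  have hn : ‖(EuclideanSpace.single b (1 : ℝ) : V3)‖ = 1 := by simp
  have hin : ⟪v - w, (EuclideanSpace.single b (1 : ℝ) : V3)⟫_ℝ = v b - w b := by
    rw [EuclideanSpace.inner_single_right]; simp
  simp only [reflectVel, hn, hin, one_pow, div_one]

/-- With a FRESH partner (`W p.2 = 0`) a step at the coordinate normal `e_b` kills the `b`-component of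
`W p.1` and keeps the others. -/
theorem mstep_fresh_apply {n : ℕ} {p : Fin n × Fin n} (hp : p.1 ≠ p.2) (b : Fin 3) (W : Fin n → V3)
    (hW : W p.2 = 0) (c : Fin 3) :
    mstep p (EuclideanSpace.single b (1 : ℝ)) W p.1 c = if c = b then 0 else W p.1 c := by
  unfold mstep
  rw [collidePair_apply_left hp]
  simp only [Euclidean.geometry, Pi.single_eq_same, Pi.single_eq_of_ne hp.symm, sub_zero, hW]
  rw [reflectVel_coordinate]
  by_cases h : c = b
  · subst h; simp
  · simp [h]

/-- Particles other than the pair are untouched. -/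
theorem mstep_apply_of_ne {n : ℕ} {p : Fin n × Fin n} (nrm : V3) (W : Fin n → V3) {k : Fin n}
    (h1 : k ≠ p.1) (h2 : k ≠ p.2) : mstep p nrm W k = W k := by
  unfold mstep
  rw [collidePair_apply_of_ne h1 h2]

/-- TIGHTNESS of `a_ii ≥ 3 − m_i`: three own collisions at the coordinate normals `e₀, e₁, e₂` with three fresh
partners EMPTY the self-block: the output at particle `0` of any input concentrated at `0` vanishes. -/
theorem selfBlock_zero_after_three (x : V3) :
    mstep ((0 : Fin 4), (3 : Fin 4)) (EuclideanSpace.single 2 (1 : ℝ))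
      (mstep ((0 : Fin 4), (2 : Fin 4)) (EuclideanSpace.single 1 (1 : ℝ))
        (mstep ((0 : Fin 4), (1 : Fin 4)) (EuclideanSpace.single 0 (1 : ℝ)) (Pi.single (0 : Fin 4) x))) 0 = 0 := by
  set W1 := mstep ((0 : Fin 4), (1 : Fin 4)) (EuclideanSpace.single 0 (1 : ℝ)) (Pi.single (0 : Fin 4) x) with hW1
  set W2 := mstep ((0 : Fin 4), (2 : Fin 4)) (EuclideanSpace.single 1 (1 : ℝ)) W1 with hW2
  have h1 : ∀ c : Fin 3, W1 0 c = if c = 0 then 0 else x c := by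
    intro c
    have := mstep_fresh_apply (p := ((0 : Fin 4), (1 : Fin 4))) (by decide) 0 (Pi.single (0 : Fin 4) x)
      (by simp) c
    simpa [hW1] using this
  have hW1_2 : W1 2 = 0 := by
    rw [hW1, mstep_apply_of_ne _ _ (by decide) (by decide)]; simp
  have hW1_3 : W1 3 = 0 := by
    rw [hW1, mstep_apply_of_ne _ _ (by decide) (by decide)]; simp
  have h2 : ∀ c : Fin 3, W2 0 c = if c = 1 then 0 else W1 0 c := by
    intro c
    have := mstep_fresh_apply (p := ((0 : Fin 4), (2 : Fin 4))) (by decide) 1 W1 hW1_2 c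
    simpa [hW2] using this
  have hW2_3 : W2 3 = 0 := by
    rw [hW2, mstep_apply_of_ne _ _ (by decide) (by decide), hW1_3]
  have h3 : ∀ c : Fin 3, mstep ((0 : Fin 4), (3 : Fin 4)) (EuclideanSpace.single 2 (1 : ℝ)) W2 0 c =
      if c = 2 then 0 else W2 0 c := fun c =>
    mstep_fresh_apply (p := ((0 : Fin 4), (3 : Fin 4))) (by decide) 2 W2 hW2_3 c
  ext c
  rw [h3 c]
  fin_cases c <;> simp [h2, h1]

end Tightness

/-! ## §8 Numerics (kit) — pre-registered reading rule; results appended when the jobs return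

Jobs (self-attaching to the item as `compute-<id>.json`; script `mdjob/main.py` in the seat folder: event-driven
hard-sphere MD on the unit 3-torus carrying the crux's transfer in the column picture for 64 tagged sources;
`ipr` in the crux's normalisation, 9 fresh, floor `9/N`; also the idle fraction, `9·idle ≤ ipr` by F3):
* `j008615` (plan `scaling`): equilibrium, φ = 0.05, N = 256 / 512 / 1024 / 2048 / 4096, mean ipr vs collisions
  per particle (cpp) up to 30.
* `j008619` (plan `noneq`): NON-equilibrium local-Gibbs starts, N = 1024 (2048 for the long implosion): shear
  `u_x = 5 sin 2πy`; implosions `u = −A sin 2πx` (A = 3, 10 at φ = 0.05; A = 5 at φ = 0.20); hot/cold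
  `θ = 1 + 0.9 sin 2πx`; cold counter-streaming slabs (`θ = 0.05`, `u_x = ±3`); successive windows of 8 cpp with
  the macrostate (density contrast, cell temperatures) logged at each window start.
READING RULE (fixed before the runs). Evidence AGAINST the crux: (a) in `scaling`, a level-off of mean ipr at a
value `≫ 9/N` that does not halve when `N` doubles (an `N`-independent plateau); (b) in `noneq`, a window whose
ipr-vs-cpp curve stalls above `1` for `≥ 8` cpp while `9·idle` is already small (reconcentration / degenerate
normals rather than collision poverty). CONSISTENT with the crux: `N`-independent decay per cpp down to `O(9/N)`;
slower decay in non-equilibrium windows fully accounted for by `9·idle` (collision-poor sub-populations, which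
`n_N → ∞` removes) or by a rate change of `O(1)`.
RESULTS (jobs re-run as j013787 `scaling` / j013790 `noneq`, self-attached; smoke j008403; full tables in `MD-RESULTS.md` on
the item). Integrity: 0 bad separations, column budget to 2e-14, no overlap.
(a) `scaling`, φ = 0.05, mean ipr at cpp 3 / 8 / 12 / 16 / 20 / 25 / 30:
    N =  256: 3.03 / 0.70 / 0.26 / 0.124 / 0.073 / 0.050 / 0.045   (floor 0.035)
    N =  512: 2.82 / 0.67 / 0.26 / 0.105 / 0.053 / 0.031 / 0.024   (floor 0.018)
    N = 1024: 2.96 / 0.72 / 0.25 / 0.094 / 0.045 / 0.020 / 0.013   (floor 0.0088)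
    N = 2048: 3.15 / 0.77 / 0.27 / 0.112 / 0.038 / 0.016 / 0.008   (floor 0.0044)
    N = 4096: 2.42 / 0.57 / 0.21 / 0.076 / 0.031 / 0.011 / 0.005   (floor 0.0022)
    — `N`-independent decay (`−log(ipr/9) ≈ 0.30` per cpp) down to ≈ 12–16 cpp, then the curve bends to the floor and the
    30-cpp value HALVES when `N` doubles; mean self-block `a_ii` at 30 cpp = 3/N to two digits (uniform). NO plateau.
(b) `noneq` (N = 1024, 8-cpp windows; equilibrium reference 0.72 at 8 cpp): shear, hot/cold, cold counter-streaming slabs and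
    every post-transient implosion window follow the equilibrium curve (0.58–0.85 at 8 cpp, `9·idle ≤ 0.03`); ONLY the first window
    of the violent implosions is slower (A = 10, φ = 0.05: 1.90; A = 5, φ = 0.20: 2.32; N = 2048 long run: 2.62 at 8 and 1.72 at
    12 cpp) and there `9·idle` is still 0.86–1.39 — collision-count heterogeneity (the compressed core hoards the collisions), i.e.
    the FewCollisionsRare mechanism of F3/F7; once `9·idle → 0` it catches up (N = 2048 w0: 0.52 / 0.17 / 0.053 / 0.019 at
    16 / 20 / 25 / 30 cpp vs equilibrium 0.112 / 0.038 / 0.016 / 0.008) and the post-shock window is the equilibrium curve.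
    NO window stalls above 1 with small `9·idle`.
VERDICT by the pre-registered rule: CONSISTENT with the crux on both counts; the non-equilibrium flank is benign at N ≤ 2048.
Not tested: N > 4096, > 30 cpp, adversarial measure-zero data, droplets at packing near freezing (bulk φ = 0.45: j007601). -/

-- Targets
-- (none yet: payload.targets = []; stuck stubs of the picked line go here on re-arm)

end

end Summit.AtomisticToContinuum.HydrodynamicLimit.Cruxes.DiffuseBackwardInfluence.Disproof
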